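import Summits.Ventures.Crystal3D.Theorems.StickyWulffConstantCoaxialWallLawBarlowOneFccCellHyps
import Summits.Ventures.Crystal3D.Theorems.StickyWulffConstantGenericWallFloorCredits
import Literature.MathematicalPhysics.StatisticalMechanics.BarlowCoordination
import HarnessLib

/-!
# The ONE-FCC F_layer cell: deep clamp balls are SATURATED, so the widened payer window costs O(ρ) (file (E), part 1, of the assembly plan)

HONEST FRAMING. Venture `Summits/Ventures/Crystal3D` (cell `crystal3d-full`); helper `--supports` the crux `CoaxialWallLaw`
(stmt-Ventures-19481, REGISTERED line `WallLedgerF`) in its role as owner of lane T's debt T-F2 / F_layer — TexShadow v8.4's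
`stub_fLayerOneFcc` (cf-p1 (civ)/(cx); HOME/wall-19481-p1/g15/ONEFCC-ASSEMBLY-PLAN-g15.md file (E)).  Census-free, standard axioms;
nothing about the crux is claimed; F-C1 not moved.

The row cell `oneFcc_rawSources_le_payers` (…BarlowOneFccRow) pays with the payer window `[−(R₀+1)−2, h+(R₀+1)+2]`, one unit wider on
each side than the window `[−R₀−2, h+R₀+2]` of lane T's currency glue `bilayerWallAt_of_payerBound` (…BilayerWallBookkeeping).  The two
extra height-one bands lie inside the clamps, where plate balls away from the lateral rim are SATURATED:
* `twelve_le_deg_of_plateBall` — a plate ball whose radius-`1` ball lies in the clamped region has `deg ≥ 12` (the twelve stacking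
  neighbours of a Barlow site, Literature `ncard_touching_barlowPos`, pushed forward by the plate isometry);
* `deg_ge_twelve_band₁` / `deg_ge_twelve_band₂` — every ball of `X` in the bottom band `[−R₀−3, −R₀−2]` (resp. the top band
  `[h+R₀+2, h+R₀+3]`) within lateral radius `ρ − 2` has `deg ≥ 12` (it is a plate site by the covering/separation argument of
  …BarlowOneFccCellHyps, and its unit ball is clamped);
* **`extraPayers_card_le₁/₂`** — hence the payers (`deg ≤ 11`) of the two extra bands lie in the lateral annulus `(ρ−2, ρ]` and number at
  most `144·ρ` each (`card_mul_le_of_separated_in_shell`).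
WHAT THIS IS NOT: not the sum conversion itself nor the final assembly; F-C1 not moved.
-/

noncomputable section

namespace Summit.Ventures.Crystal3D.Theorems

open Summit.Ventures.Crystal3D Finset
open Literature.MathematicalPhysics.StatisticalMechanics (barlowPos barlowStacking IsHaggSeq barlowPos_mem ncard_touching_barlowPos)
open Summit.Ventures.Crystal3D.Cruxes.TextureLiminf.TexShadow (E3 stacking)
open scoped InnerProductSpace

section Saturated

variable {σ : ℤ → ℤ} (hσ : IsHaggSeq σ) (L : E3 ≃ₗᵢ[ℝ] E3) (s : E3) {X : Finset E3} {W : Set E3}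
  (hplate : ∀ p ∈ stacking L s σ, p ∈ W → p ∈ X) (k i j : ℤ)
  (hW : ∀ x, dist (L (barlowPos 1 (Real.sqrt (2 / 3)) σ k i j) + s) x ≤ 1 → x ∈ W)

include hσ hplate hW

open scoped Classical in
/-- **A plate ball whose unit ball is clamped is saturated**: `deg ≥ 12`. -/
theorem twelve_le_deg_of_plateBall :
    12 ≤ (X.filter fun q => dist (L (barlowPos 1 (Real.sqrt (2 / 3)) σ k i j) + s) q = 1).card := by
  set q₀ := barlowPos 1 (Real.sqrt (2 / 3)) σ k i j with hq₀
  set N : Set E3 := {w | w ∈ barlowStacking 1 (Real.sqrt (2 / 3)) σ ∧ dist q₀ w = 1} with hN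
  have hh : Real.sqrt (2 / 3) ^ 2 = 2 / 3 * (1 : ℝ) ^ 2 := by rw [Real.sq_sqrt (by norm_num)]; ring
  have hN12 : N.ncard = 12 := ncard_touching_barlowPos hσ one_pos hh k i j
  set f : E3 → E3 := fun w => L w + s with hf
  have hfinj : Function.Injective f := fun a b hab => L.injective (add_right_cancel hab)
  have hsub : f '' N ⊆ ↑(X.filter fun q => dist (L q₀ + s) q = 1) := by
    rintro _ ⟨w, ⟨hw, hd⟩, rfl⟩
    have hd' : dist (L q₀ + s) (L w + s) = 1 := by rw [dist_add_right, L.dist_map, hd]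
    have hmem : L w + s ∈ X := hplate _ ⟨w, hw, rfl⟩ (hW _ hd'.le)
    exact mem_coe.2 (mem_filter.2 ⟨hmem, hd'⟩)
  have hfin : (↑(X.filter fun q => dist (L q₀ + s) q = 1) : Set E3).Finite := Finset.finite_toSet _
  have h1 : (f '' N).ncard = 12 := by rw [Set.ncard_image_of_injective _ hfinj, hN12]
  have h2 := Set.ncard_le_ncard hsub hfin
  rw [h1, Set.ncard_coe_finset] at h2
  exact h2

end Saturated

section Bands

variable {σ₁ σ₂ : ℤ → ℤ} (hσ₁ : IsHaggSeq σ₁) (hσ₂ : IsHaggSeq σ₂) (L₁ L₂ : E3 ≃ₗᵢ[ℝ] E3) (s₁ s₂ : E3)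
  {X P₁ P₂ : Finset E3} {R₀ h ρ : ℝ}
  (hX : ∀ p ∈ X, ∀ q ∈ X, p ≠ q → 1 ≤ dist p q) (hP₁X : P₁ ⊆ X) (hP₂X : P₂ ⊆ X)
  (hcell : ∀ p ∈ X, -(2 * R₀) ≤ p 2 ∧ p 2 ≤ h + 2 * R₀ ∧ p 0 ^ 2 + p 1 ^ 2 ≤ ρ ^ 2)
  (hP₁ : ∀ p, p ∈ P₁ ↔ (p ∈ stacking L₁ s₁ σ₁ ∧ -(2 * R₀) ≤ p 2 ∧ p 2 ≤ -R₀ ∧ p 0 ^ 2 + p 1 ^ 2 ≤ ρ ^ 2))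
  (hP₂ : ∀ p, p ∈ P₂ ↔ (p ∈ stacking L₂ s₂ σ₂ ∧ h + R₀ ≤ p 2 ∧ p 2 ≤ h + 2 * R₀ ∧ p 0 ^ 2 + p 1 ^ 2 ≤ ρ ^ 2))

include hσ₁ hX hP₁X hP₁ in
open scoped Classical in
/-- **Bottom extra band is saturated off the rim**: a ball of `X` with `−R₀−3 ≤ z₂ ≤ −R₀−2` and lateral radius `≤ ρ−2` has `deg ≥ 12`
(`R₀ ≥ 4`, `ρ ≥ 2`). -/
theorem deg_ge_twelve_band₁ (hR₀ : 4 ≤ R₀) (hρ : 2 ≤ ρ) {z : E3} (hz : z ∈ X) (h1 : -(R₀ + 1) - 2 ≤ z 2)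
    (h2 : z 2 ≤ -(R₀ + 1) - 1) (h3 : z 0 ^ 2 + z 1 ^ 2 ≤ (ρ - 1 - 1) ^ 2) :
    12 ≤ (X.filter fun q => dist z q = 1).card := by
  -- `z` is a plate site (covering radius + separation), as in `sealing_below_barlow`
  obtain ⟨p, hp, hd⟩ := exists_site_near_of_stacking σ₁ L₁ s₁ z
  have hd1 : dist z p < 1 := by nlinarith [dist_nonneg (x := z) (y := p)]
  have hzc := abs_sub_apply_le_dist' p z 2
  rw [dist_comm] at hzc
  obtain ⟨hlo, hhi⟩ := abs_le.1 (hzc.trans hd1.le)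
  have hlat := lateral_radius_le_add_dist p z
  rw [dist_comm] at hlat
  have hsl := sqrt_lateral_le_of_sq_le (by linarith : (0 : ℝ) ≤ ρ - 1 - 1) h3
  have hpP : p ∈ P₁ := (hP₁ p).2 ⟨hp, by linarith, by linarith,
    lateral_sq_le_of_sqrt_le (by linarith) (by linarith)⟩
  have hzp : z = p := by
    by_contra hne
    have := hX z hz p (hP₁X hpP) hne
    linarith
  subst hzp
  obtain ⟨q, ⟨k, i, j, rfl⟩, rfl⟩ := hp
  refine twelve_le_deg_of_plateBall hσ₁ L₁ s₁ (W := {x : E3 | -(2 * R₀) ≤ x 2 ∧ x 2 ≤ -R₀ ∧ x 0 ^ 2 + x 1 ^ 2 ≤ ρ ^ 2})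
    (plate_mem_of_clamp₁ L₁ s₁ hP₁X hP₁) k i j fun x hx => ?_
  have hx2 := abs_sub_apply_le_dist' x (L₁ (barlowPos 1 (Real.sqrt (2 / 3)) σ₁ k i j) + s₁) 2
  rw [dist_comm] at hx
  obtain ⟨ha, hb⟩ := abs_le.1 (hx2.trans hx)
  have hxl := lateral_radius_le_add_dist x (L₁ (barlowPos 1 (Real.sqrt (2 / 3)) σ₁ k i j) + s₁)
  exact ⟨by linarith, by linarith, lateral_sq_le_of_sqrt_le (by linarith) (by linarith)⟩

include hσ₂ hX hP₂X hP₂ in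
open scoped Classical in
/-- **Top extra band is saturated off the rim**: a ball of `X` with `h+R₀+2 ≤ z₂ ≤ h+R₀+3` and lateral radius `≤ ρ−2` has `deg ≥ 12`
(`R₀ ≥ 4`, `ρ ≥ 2`). -/
theorem deg_ge_twelve_band₂ (hR₀ : 4 ≤ R₀) (hρ : 2 ≤ ρ) {z : E3} (hz : z ∈ X) (h1 : h + (R₀ + 1) + 1 ≤ z 2)
    (h2 : z 2 ≤ h + (R₀ + 1) + 2) (h3 : z 0 ^ 2 + z 1 ^ 2 ≤ (ρ - 1 - 1) ^ 2) :
    12 ≤ (X.filter fun q => dist z q = 1).card := by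
  obtain ⟨p, hp, hd⟩ := exists_site_near_of_stacking σ₂ L₂ s₂ z
  have hd1 : dist z p < 1 := by nlinarith [dist_nonneg (x := z) (y := p)]
  have hzc := abs_sub_apply_le_dist' p z 2
  rw [dist_comm] at hzc
  obtain ⟨hlo, hhi⟩ := abs_le.1 (hzc.trans hd1.le)
  have hlat := lateral_radius_le_add_dist p z
  rw [dist_comm] at hlat
  have hsl := sqrt_lateral_le_of_sq_le (by linarith : (0 : ℝ) ≤ ρ - 1 - 1) h3
  have hpP : p ∈ P₂ := (hP₂ p).2 ⟨hp, by linarith, by linarith,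
    lateral_sq_le_of_sqrt_le (by linarith) (by linarith)⟩
  have hzp : z = p := by
    by_contra hne
    have := hX z hz p (hP₂X hpP) hne
    linarith
  subst hzp
  obtain ⟨q, ⟨k, i, j, rfl⟩, rfl⟩ := hp
  refine twelve_le_deg_of_plateBall hσ₂ L₂ s₂ (W := {x : E3 | h + R₀ ≤ x 2 ∧ x 2 ≤ h + 2 * R₀ ∧ x 0 ^ 2 + x 1 ^ 2 ≤ ρ ^ 2})
    (plate_mem_of_clamp₂ L₂ s₂ hP₂X hP₂) k i j fun x hx => ?_
  have hx2 := abs_sub_apply_le_dist' x (L₂ (barlowPos 1 (Real.sqrt (2 / 3)) σ₂ k i j) + s₂) 2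
  rw [dist_comm] at hx
  obtain ⟨ha, hb⟩ := abs_le.1 (hx2.trans hx)
  have hxl := lateral_radius_le_add_dist x (L₂ (barlowPos 1 (Real.sqrt (2 / 3)) σ₂ k i j) + s₂)
  exact ⟨by linarith, by linarith, lateral_sq_le_of_sqrt_le (by linarith) (by linarith)⟩

include hσ₁ hX hP₁X hcell hP₁ in
open scoped Classical in
/-- **The payers of the bottom extra band are rim balls, at most `144·ρ` of them** (`R₀ ≥ 4`, `ρ ≥ 3`). -/
theorem extraPayers_card_le₁ (hR₀ : 4 ≤ R₀) (hρ : 3 ≤ ρ) :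
    ((X.filter fun z => (X.filter fun q => dist z q = 1).card ≤ 11 ∧
        -(R₀ + 1) - 2 ≤ z 2 ∧ z 2 < -R₀ - 2).card : ℝ) ≤ 144 * ρ := by
  set S := X.filter fun z => (X.filter fun q => dist z q = 1).card ≤ 11 ∧ -(R₀ + 1) - 2 ≤ z 2 ∧ z 2 < -R₀ - 2 with hS
  have hsep : ∀ p ∈ S, ∀ q ∈ S, p ≠ q → 1 ≤ dist p q :=
    fun p hp q hq hpq => hX p (mem_filter.1 hp).1 q (mem_filter.1 hq).1 hpq
  have hmem : ∀ p ∈ S, -(R₀ + 1) - 2 ≤ p 2 ∧ p 2 ≤ -R₀ - 2 ∧ (ρ - 1 - 1) ^ 2 < p 0 ^ 2 + p 1 ^ 2 ∧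
      p 0 ^ 2 + p 1 ^ 2 ≤ ρ ^ 2 := by
    intro p hp
    obtain ⟨hpX, hdeg, h1, h2⟩ := mem_filter.1 hp
    refine ⟨h1, h2.le, ?_, (hcell p hpX).2.2⟩
    by_contra hle
    push Not at hle
    have := deg_ge_twelve_band₁ hσ₁ L₁ s₁ hX hP₁X hP₁ hR₀ (by linarith) hpX h1 (by linarith) hle
    omega
  have key := card_mul_le_of_separated_in_shell S hsep (-(R₀ + 1) - 2) (-R₀ - 2) (ρ - 1 - 1) ρ (by linarith)
    (by linarith) (by linarith) hmem
  have e : (-R₀ - 2 - (-(R₀ + 1) - 2) + 2) * (Real.pi * (ρ + 1) ^ 2 - Real.pi * (ρ - 1 - 1 - 1) ^ 2) =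
      (Real.pi / 6) * (144 * ρ - 144) := by ring
  rw [e] at key
  have hπ : 0 < Real.pi / 6 := by positivity
  have := le_of_mul_le_mul_right (by linarith [key] : (S.card : ℝ) * (Real.pi / 6) ≤ (144 * ρ - 144) * (Real.pi / 6)) hπ
  linarith

include hσ₂ hX hP₂X hcell hP₂ in
open scoped Classical in
/-- **The payers of the top extra band are rim balls, at most `144·ρ` of them** (`R₀ ≥ 4`, `ρ ≥ 3`). -/
theorem extraPayers_card_le₂ (hR₀ : 4 ≤ R₀) (hρ : 3 ≤ ρ) :
    ((X.filter fun z => (X.filter fun q => dist z q = 1).card ≤ 11 ∧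
        h + R₀ + 2 < z 2 ∧ z 2 ≤ h + (R₀ + 1) + 2).card : ℝ) ≤ 144 * ρ := by
  set S := X.filter fun z => (X.filter fun q => dist z q = 1).card ≤ 11 ∧ h + R₀ + 2 < z 2 ∧ z 2 ≤ h + (R₀ + 1) + 2 with hS
  have hsep : ∀ p ∈ S, ∀ q ∈ S, p ≠ q → 1 ≤ dist p q :=
    fun p hp q hq hpq => hX p (mem_filter.1 hp).1 q (mem_filter.1 hq).1 hpq
  have hmem : ∀ p ∈ S, h + R₀ + 2 ≤ p 2 ∧ p 2 ≤ h + (R₀ + 1) + 2 ∧ (ρ - 1 - 1) ^ 2 < p 0 ^ 2 + p 1 ^ 2 ∧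
      p 0 ^ 2 + p 1 ^ 2 ≤ ρ ^ 2 := by
    intro p hp
    obtain ⟨hpX, hdeg, h1, h2⟩ := mem_filter.1 hp
    refine ⟨h1.le, h2, ?_, (hcell p hpX).2.2⟩
    by_contra hle
    push Not at hle
    have := deg_ge_twelve_band₂ hσ₂ L₂ s₂ hX hP₂X hP₂ hR₀ (by linarith) hpX (by linarith) h2 hle
    omega
  have key := card_mul_le_of_separated_in_shell S hsep (h + R₀ + 2) (h + (R₀ + 1) + 2) (ρ - 1 - 1) ρ (by linarith)
    (by linarith) (by linarith) hmem
  have e : (h + (R₀ + 1) + 2 - (h + R₀ + 2) + 2) * (Real.pi * (ρ + 1) ^ 2 - Real.pi * (ρ - 1 - 1 - 1) ^ 2) =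
      (Real.pi / 6) * (144 * ρ - 144) := by ring
  rw [e] at key
  have hπ : 0 < Real.pi / 6 := by positivity
  have := le_of_mul_le_mul_right (by linarith [key] : (S.card : ℝ) * (Real.pi / 6) ≤ (144 * ρ - 144) * (Real.pi / 6)) hπ
  linarith

end Bands

end Summit.Ventures.Crystal3D.Theorems

end
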